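import Literature.AlgebraicGeometry.Frobenioids.PadicKummerRemark242Exists
import Literature.NumberTheory.GaloisRepresentations.LocalFieldPadicProofs
import HarnessLib

/-!
# Frobenioids II, Remark 2.4.2: `ActsOnFNByPower` and `InvariantIncompatible` are PREDICATES on
# `Ψ`-data — universal closures refuted, closed instances over `ℚ_p` proved

Proof-only companion (abc-iut cell, block F fact-proving wave, seat abc-iut-f-048; FACT-LIST rows
F-0727 `PadicKummer.ActsOnFNByPower` and F-1197 `PadicKummer.InvariantIncompatible`, both
`kernel_closedness = parametrised`) to abc-iut-L1-t7's `PadicKummerSetting.lean`, on top of the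
Remark 2.4.2 chain of abc-iut-w5-d097 / abc-iut-w5-d248 (`PadicKummerRemark242Logic`, `…Witness`,
`…Arith`, `…Thm24i`, `…Saturated`, `…Exists`) and abc-iut-L1-t7's Remark 2.2.1
(`exists_isNHSaturated_ofLocalField`).

S. Mochizuki, *The geometry of Frobenioids II*, Kyushu J. Math. **62** (2008) 401–460, Remark 2.4.2
p. 22 [cite: MochizukiFrdII2008, Rmk 2.4.2 p.22]: "if the `Φᵢ` are not fieldwise saturated, then the
natural isomorphisms `F_N(Aᵢ) ⥲ ℤ/Nℤ` are not, in general, compatible with the isomorphism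
`F_N(A₁) ⥲ F_N(A₂)` induced by `Ψ` … an example of such a `Ψ` is provided by the unit-wise Frobenius
functor of [FrdI], Proposition 2.9, (ii), which acts on `F_N(Aᵢ)` [relative to the natural
isomorphisms `F_N(Aᵢ) ⥲ ℤ/Nℤ`] by raising to the `ζ`-th power."

The two rows name PREDICATES on comparison data `T : Thm24Data X₁ X₂ N`, invariant isomorphisms
`invᵢ : F_N(Aᵢ) ⥲ ℤ/Nℤ` and a power `ζ` — the vocabulary in which the remark is typed — not closed
claims.  Per the cell's rule for parametrised rows (plan R1, 2026-08-26):

* (ii) the universal closures are FALSE: `not_forall_actsOnFNByPower` (no data act by two different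
  powers — abc-iut-w5-d097's `actsOnFNByPower_unique` — and data acting by `ζ ≠ 1` exist) and
  `not_forall_invariantIncompatible` (for ANY `T`, `inv₁` the transported invariant isomorphism
  `inv₁ ∘ T.isoFN⁻¹` of `F_N(A₂)` IS compatible: `not_invariantIncompatible_transport`); finer,
  instance-wise forms: `not_actsOnFNByPower_zero` (`N ≠ 1`), `not_forall_zeta_actsOnFNByPower`,
  `not_forall_inv_invariantIncompatible`;
* the INSTANCE FORMS are PROVED, hypothesis-free, at abc-iut-L1-t7's arithmetic context
  `ofLocalField L H hH O^×_L` over `K = ℚ_p` (`Φ` absolutely primitive, `O^□ = O^×`):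
  `exists_actsOnFNByPower_and_invariantIncompatible_padic` — for every prime `p`, open normal
  `H ⊆ G_{ℚ_p}` and `N > 2` there are a finite Galois `L/ℚ_p`, an `(N, H)`-saturated object, a
  natural isomorphism `inv : F_N(A) ⥲ ℤ/Nℤ` and `Ψ`-data (the `ℓ`-th power automorphism of the
  Definition 2.2 data, `ℓ ≡ −1 (mod N)` prime — the unit-wise Frobenius shadow) which ACT ON `F_N(A)`
  BY THE `ℓ`-TH POWER, `ℓ ≢ 1`, and are `InvariantIncompatible` — and the closed `0`-ary corollary
  `exists_actsOnFNByPower_ne_one_and_invariantIncompatible` (`p = 2`, `H = G_{ℚ_2}`, `N = 3`).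

Inputs, all PROVED in the tree: `Padic.isNonarchimedeanLocalField_holds` (`ℚ_p` is a non-archimedean
local field), `exists_isNHSaturated_ofLocalField` (Rmk. 2.2.1), `nonempty_fn_equiv_zmod_ofLocalField`
("`F_N(A) ≅ ℤ/Nℤ`"), `GalMonoid.exists_prime_pow_bijective_and_natCast_eq` (Dirichlet),
`Def22Context.rmk242_witness_thm24i_and_incompatible` (the witness).  This file declares theorems
only (no definition, no instance, no named fact); nothing here concerns [IUTchIII]; no side taken on
Cor. 3.12; no statement of [FrdII] is asserted false — a predicate has instances on both sides, and
the positive instances below are exactly print's example.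
-/

noncomputable section

namespace Literature.AlgebraicGeometry.Frobenioids

namespace PadicKummer

/-! ### (A) The schemas fail at every instance -/

section Schema

variable {X₁ X₂ : Def22Context} {N : ℕ}

/-- For ANY comparison data `T` and ANY `inv₁ : F_N(A₁) ⥲ ℤ/Nℤ`, the transported isomorphism
`inv₁ ∘ T.isoFN⁻¹ : F_N(A₂) ⥲ ℤ/Nℤ` is compatible with `T` — so `InvariantIncompatible` is a condition
on the PAIR of natural isomorphisms, never automatic. [cite: MochizukiFrdII2008, Rmk 2.4.2 p.22] -/
theorem not_invariantIncompatible_transport (T : Thm24Data X₁ X₂ N) (inv₁ : FNInvariant X₁ N) :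
    ¬ InvariantIncompatible X₁ X₂ N T inv₁ ⟨T.isoFN.symm.trans inv₁.toAddEquiv⟩ := by
  rintro ⟨x, hx⟩
  apply hx
  show (T.isoFN.symm.trans inv₁.toAddEquiv) (T.isoFN x) = inv₁.toAddEquiv x
  rw [AddEquiv.trans_apply, AddEquiv.symm_apply_apply]

/-- Hence at every instance `(X₁, X₂, N, T, inv₁)` the closure over `inv₂` of `InvariantIncompatible`
fails. [cite: MochizukiFrdII2008, Rmk 2.4.2 p.22] -/
theorem not_forall_inv_invariantIncompatible (T : Thm24Data X₁ X₂ N) (inv₁ : FNInvariant X₁ N) :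
    ¬ ∀ inv₂ : FNInvariant X₂ N, InvariantIncompatible X₁ X₂ N T inv₁ inv₂ :=
  fun h => not_invariantIncompatible_transport T inv₁ (h _)

/-- No `Ψ`-data act on `F_N` by the `0`-th power (relative to natural isomorphisms `F_N(Aᵢ) ⥲ ℤ/Nℤ`)
unless `N = 1`: `F_N(A₁) ⥲ F_N(A₂) ⥲ ℤ/Nℤ` is injective and `ℤ/Nℤ` has two elements.
[cite: MochizukiFrdII2008, Rmk 2.4.2 p.22] -/
theorem not_actsOnFNByPower_zero (hN : N ≠ 1) (T : Thm24Data X₁ X₂ N) (inv₁ : FNInvariant X₁ N)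
    (inv₂ : FNInvariant X₂ N) : ¬ ActsOnFNByPower X₁ X₂ N T inv₁ inv₂ 0 := by
  haveI : Nontrivial (ZMod N) := ZMod.nontrivial_iff.mpr hN
  intro h
  have h1 := h (inv₁.toAddEquiv.symm 1)
  have h0 := h (inv₁.toAddEquiv.symm 0)
  rw [zero_mul] at h1 h0
  have e : inv₁.toAddEquiv.symm 1 = inv₁.toAddEquiv.symm 0 :=
    T.isoFN.injective (inv₂.toAddEquiv.injective (h1.trans h0.symm))
  exact one_ne_zero (inv₁.toAddEquiv.symm.injective e)

/-- Hence at every instance with `N ≠ 1` the closure over `ζ` of `ActsOnFNByPower` fails.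
[cite: MochizukiFrdII2008, Rmk 2.4.2 p.22] -/
theorem not_forall_zeta_actsOnFNByPower (hN : N ≠ 1) (T : Thm24Data X₁ X₂ N)
    (inv₁ : FNInvariant X₁ N) (inv₂ : FNInvariant X₂ N) :
    ¬ ∀ ζ : ZMod N, ActsOnFNByPower X₁ X₂ N T inv₁ inv₂ ζ :=
  fun h => not_actsOnFNByPower_zero hN T inv₁ inv₂ (h 0)

/-- Data acting by a power `ζ ≠ 1` do not act by the first power (the power is unique,
`actsOnFNByPower_unique`), i.e. are not compatible with the natural isomorphisms.
[cite: MochizukiFrdII2008, Rmk 2.4.2 p.22] -/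
theorem not_actsOnFNByPower_one_of_ne {ζ : ZMod N} (hζ : ζ ≠ 1) (T : Thm24Data X₁ X₂ N)
    (inv₁ : FNInvariant X₁ N) (inv₂ : FNInvariant X₂ N) (h : ActsOnFNByPower X₁ X₂ N T inv₁ inv₂ ζ) :
    ¬ ActsOnFNByPower X₁ X₂ N T inv₁ inv₂ 1 :=
  fun h1 => hζ (actsOnFNByPower_unique T inv₁ inv₂ h h1)

end Schema

/-! ### (B) The instance forms over `ℚ_p`, hypothesis-free -/

namespace Def22Context

open Field Kummer
open Literature.NumberTheory.GaloisRepresentations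

/-- **Remark 2.4.2, both predicates INHABITED at the arithmetic context over `ℚ_p`** (FrdII p. 22
with Rmk. 2.2.1 p. 18 and "`F_N(A) ≅ ℤ/Nℤ`" p. 18): for every prime `p`, open normal `H ⊆ G_{ℚ_p}` and
`N > 2` there is a finite Galois `L/ℚ_p` such that the object `A = (L, O^×_L)` of the context
`ofLocalField L H hH O^×_L` is `(N, H)`-saturated and carries a natural isomorphism
`inv : F_N(A) ⥲ ℤ/Nℤ` and `Ψ`-data `T` (the comparison data of the `ℓ`-th power automorphism of the
Definition 2.2 data, `ℓ` a prime `≡ −1 (mod N)` acting bijectively on `O^×_L` — print's unit-wise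
Frobenius example) which ACT ON `F_N(A)` BY THE `ζ`-TH POWER with `ζ = ℓ ≢ 1 (mod N)` and are
`InvariantIncompatible`. [cite: MochizukiFrdII2008, Rmk 2.4.2 p.22] -/
theorem exists_actsOnFNByPower_and_invariantIncompatible_padic (p : ℕ) [Fact p.Prime]
    (H : Subgroup (absoluteGaloisGroup ℚ_[p])) [H.Normal]
    (hH : IsOpen (H : Set (absoluteGaloisGroup ℚ_[p]))) (N : ℕ) (hN : 2 < N) :
    ∃ (L : IntermediateField ℚ_[p] (AlgebraicClosure ℚ_[p])) (_ : FiniteDimensional ℚ_[p] L)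
      (_ : IsGalois ℚ_[p] L)
      (_ : IsNHSaturated (ofLocalField L H hH (unitsStableSubmonoid ℚ_[p] L)) N)
      (T : Thm24Data (ofLocalField L H hH (unitsStableSubmonoid ℚ_[p] L))
        (ofLocalField L H hH (unitsStableSubmonoid ℚ_[p] L)) N)
      (inv : FNInvariant (ofLocalField L H hH (unitsStableSubmonoid ℚ_[p] L)) N) (ζ : ZMod N),
      ζ ≠ 1 ∧
        Literature.AlgebraicGeometry.Frobenioids.PadicKummer.ActsOnFNByPower _ _ N T inv inv ζ ∧
        Literature.AlgebraicGeometry.Frobenioids.PadicKummer.InvariantIncompatible _ _ N T inv inv := by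
  haveI : IsNonarchimedeanLocalField ℚ_[p] := Padic.isNonarchimedeanLocalField_holds p
  haveI : NeZero N := ⟨by omega⟩
  haveI : Fact (2 < N) := ⟨hN⟩
  haveI : FiniteDimensional ℚ_[p] (⊥ : IntermediateField ℚ_[p] (AlgebraicClosure ℚ_[p])) :=
    inferInstance
  obtain ⟨L, hfd, hgal, -, hsat⟩ := exists_isNHSaturated_ofLocalField (K := ℚ_[p]) ⊥ H hH N
  haveI := hfd
  haveI := hgal
  have h : IsNHSaturated (ofLocalField L H hH (unitsStableSubmonoid ℚ_[p] L)) N :=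
    hsat _ (unitsStableSubmonoid_mem_of_pow_eq_one L N)
  obtain ⟨f⟩ := nonempty_fn_equiv_zmod_ofLocalField L H hH (unitsStableSubmonoid ℚ_[p] L) N
    (unitsStableSubmonoid_mem_of_pow_eq_one L N)
    (rootsOfUnity_mem_of_isNHSaturated L H hH (unitsStableSubmonoid ℚ_[p] L) N h) h
  obtain ⟨ℓ, -, hbij, hℓa⟩ :=
    GalMonoid.exists_prime_pow_bijective_and_natCast_eq L N (a := -1) isUnit_one.neg
  have hne : ((ℓ : ℕ) : ZMod N) ≠ 1 := by
    rw [hℓa]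
    exact ZMod.neg_one_ne_one
  obtain ⟨e, -, -, -, -, hboth⟩ :=
    (ofLocalField L H hH (unitsStableSubmonoid ℚ_[p] L)).rmk242_witness_thm24i_and_incompatible N ℓ
      hbij hne
  exact ⟨L, hfd, hgal, h, e.thm24Data N, ⟨f⟩, (ℓ : ZMod N), hne, (hboth ⟨f⟩).1, (hboth ⟨f⟩).2⟩

/-- **Closed `0`-ary instance form of F-0727 / F-1197** (FrdII Rmk. 2.4.2 p. 22): there are a
Definition 2.2 context `X` (the arithmetic context over `ℚ_2` with `H = G_{ℚ_2}`, `O^□ = O^×`), `N`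
(`= 3`), `Ψ`-data `T`, a natural isomorphism `inv : F_N(A) ⥲ ℤ/Nℤ` and `ζ ≠ 1` such that `T` acts on
`F_N(A)` by the `ζ`-th power AND is `InvariantIncompatible`. [cite: MochizukiFrdII2008, Rmk 2.4.2 p.22] -/
theorem exists_actsOnFNByPower_ne_one_and_invariantIncompatible :
    ∃ (X : Def22Context) (N : ℕ) (T : Thm24Data X X N) (inv : FNInvariant X N) (ζ : ZMod N),
      ζ ≠ 1 ∧ Literature.AlgebraicGeometry.Frobenioids.PadicKummer.ActsOnFNByPower X X N T inv inv ζ ∧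
        Literature.AlgebraicGeometry.Frobenioids.PadicKummer.InvariantIncompatible X X N T inv inv := by
  haveI : Fact (Nat.Prime 2) := ⟨Nat.prime_two⟩
  have hH : IsOpen ((⊤ : Subgroup (absoluteGaloisGroup ℚ_[2])) : Set (absoluteGaloisGroup ℚ_[2])) := by
    rw [Subgroup.coe_top]
    exact isOpen_univ
  obtain ⟨L, _, _, _, T, inv, ζ, hζ, hact, hinc⟩ :=
    exists_actsOnFNByPower_and_invariantIncompatible_padic 2 ⊤ hH 3 (by norm_num)
  exact ⟨_, 3, T, inv, ζ, hζ, hact, hinc⟩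

end Def22Context

/-! ### (C) F-0727 / F-1197: the universal closures are false -/

/-- **F-0727 (FACT-LIST) — `ActsOnFNByPower` is a PREDICATE on `Ψ`-data, its universal closure is
false.** [FrdII] Rmk. 2.4.2 p. 22 ("acts on `F_N(Aᵢ)` … by raising to the `ζ`-th power").  Witness:
the `Ψ`-data over `ℚ_2` of `exists_actsOnFNByPower_ne_one_and_invariantIncompatible` act by some
`ζ ≠ 1`, hence NOT by `1` (`actsOnFNByPower_unique`); see also `not_actsOnFNByPower_zero` (no data act
by `0` unless `N = 1`).  Instance forms PROVED: `Def22Context.rmk242_witness` (abc-iut-w5-d248),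
`exists_actsOnFNByPower_and_invariantIncompatible_padic` (this file).
[cite: MochizukiFrdII2008, Rmk 2.4.2 p.22] -/
theorem not_forall_actsOnFNByPower :
    ¬ ∀ (X₁ X₂ : Def22Context) (N : ℕ) (T : Thm24Data X₁ X₂ N) (inv₁ : FNInvariant X₁ N)
        (inv₂ : FNInvariant X₂ N) (ζ : ZMod N),
        Literature.AlgebraicGeometry.Frobenioids.PadicKummer.ActsOnFNByPower X₁ X₂ N T inv₁ inv₂ ζ := by
  intro h
  obtain ⟨X, N, T, inv, ζ, hζ, hact, -⟩ :=
    Def22Context.exists_actsOnFNByPower_ne_one_and_invariantIncompatible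
  exact not_actsOnFNByPower_one_of_ne hζ T inv inv hact (h X X N T inv inv 1)

/-- **F-1197 (FACT-LIST) — `InvariantIncompatible` is a PREDICATE on `Ψ`-data and a pair of natural
isomorphisms, its universal closure is false.** [FrdII] Rmk. 2.4.2 p. 22 ("the natural isomorphisms
`F_N(Aᵢ) ⥲ ℤ/Nℤ` are not, in general, compatible with the isomorphism `F_N(A₁) ⥲ F_N(A₂)` induced by
`Ψ`").  Witness: for the `Ψ`-data `T` over `ℚ_2` of
`exists_actsOnFNByPower_ne_one_and_invariantIncompatible` and their `inv₁`, the transported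
isomorphism `inv₁ ∘ T.isoFN⁻¹` is compatible (`not_invariantIncompatible_transport`).  Instance forms
PROVED: `Def22Context.rmk242_vs_thm24_exists`, `rmk242_witness_invariantIncompatible`
(abc-iut-w5-d248), `exists_actsOnFNByPower_and_invariantIncompatible_padic` (this file).
[cite: MochizukiFrdII2008, Rmk 2.4.2 p.22] -/
theorem not_forall_invariantIncompatible :
    ¬ ∀ (X₁ X₂ : Def22Context) (N : ℕ) (T : Thm24Data X₁ X₂ N) (inv₁ : FNInvariant X₁ N)
        (inv₂ : FNInvariant X₂ N),
        Literature.AlgebraicGeometry.Frobenioids.PadicKummer.InvariantIncompatible X₁ X₂ N T inv₁ inv₂ := by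
  intro h
  obtain ⟨X, N, T, inv, -, -, -, -⟩ :=
    Def22Context.exists_actsOnFNByPower_ne_one_and_invariantIncompatible
  exact not_invariantIncompatible_transport T inv (h X X N T inv _)

end PadicKummer

end Literature.AlgebraicGeometry.Frobenioids

end
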